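import Summits.CriticalPhenomena.SAWScalingLimit.Theorems.CriticalBubbleBound.Negative.CriticalBubbleBoundSufficient
import Literature.Probability.RandomPlanarGeometry.HammersleyWelshBound
import Literature.Probability.RandomPlanarGeometry.SAWPolygonsFromBridges
import Literature.Probability.RandomPlanarGeometry.BDGS2012Prop13

/-!
# Negative-side results for the crux `SAWTotalPositivity.CriticalBubbleBound` (stmt-CriticalPhenomena-7117):
the DISPROOF side — what a refutation must deliver, and the PROVED WINDOW for the terms
`t_n(e) = c_n(0,e) x_cⁿ` of the bubble series: `x_c e^{-2c√M}/((2M+1)⁴(M+1)⁴) ≤ t_{2M+1}(e)`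
(Hammersley–Welsh + "two bridges make a polygon", Madras–Slade Cor. 3.1.6 + Thm 3.2.4, both
tree theorems) and `t_n(e) ≤ e^{κ√n}` (Hammersley–Welsh upper bound). The crux asks `Σ t_n < ∞`,
a refutation asks `Σ t_n = ∞`; either way a stretched exponential has to become a polynomial
(work-file §16).

Refuter `cdisprove` (standing adversary); the full indexed work file is
`Summits/CriticalPhenomena/SAWScalingLimit/Cruxes/CriticalBubbleBound/Disproof.lean`.
-/

noncomputable section

open MeasureTheory Filter Topology Set Function
open Literature.Probability.LatticeModels
open Literature.Probability.RandomPlanarGeometry Literature.Probability.RandomPlanarGeometry.SAW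
open scoped ENNReal NNReal BigOperators

namespace Summit.CriticalPhenomena.SAWScalingLimit.Theorems.CriticalBubbleBound.Negative

open Summit.CriticalPhenomena.SAWScalingLimit.Theses.SAWTotalPositivity (CriticalBubbleBound)

/-! ## §16 The DISPROOF side: what `¬ CriticalBubbleBound` needs, and the proved window for the terms -/

/-- **WHAT A REFUTATION IS**: `¬ CriticalBubbleBound ⟺` some unit vector `e` has
`Σ_n c_n(0,e) x_cⁿ = ∞` (by §10 then every unit vector does). [cite: MadrasSlade1993, §1.4] -/
theorem not_criticalBubbleBound_iff :
    ¬ CriticalBubbleBound ↔ ∃ e : Site 2, (zdGraph 2).Adj 0 e ∧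
      ∑' n : ℕ, (Zd.countAt 2 n e : ℝ≥0∞) * ENNReal.ofReal (criticalFugacity ^ n) = ⊤ := by
  rw [criticalBubbleBound_iff_tsum_countAt_ne_top]
  push Not
  rfl

/-- **PROVED LOWER BOUND ON THE TERMS** (the only one in the tree and, to this refuter's reading,
in print): for `e = (0,-1)` and every `M ≥ 1`,
`c_{2M+1}(0,e) · x_c^{2M+1} ≥ x_c · e^{-2c√M} / ((2M+1)⁴ (M+1)⁴)` — two bridges of length `M`
glued across a separating line make a `(2M+1)`-step SAW `0 → e` (Madras–Slade Theorem 3.2.4,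
tree `Zd.sq_bridgeCount_le_card_targetWalks`), and `b_M ≥ e^{-c√M} μ^M` (Hammersley–Welsh,
Corollary 3.1.6, tree `Zd.exp_mul_pow_le_bridgeCount`, `c = c₁ + 8`). The minorant is
STRETCHED-EXPONENTIALLY small, hence summable: the proved lower bounds are consistent with the
crux. A refutation needs `c_n(0,e) x_cⁿ ≥ n^{-1-o(1)}` along a set of `n` with divergent sum —
in particular POLYNOMIAL lower bounds `p_m ≥ μ^m m^{-K}` on polygon numbers, of which none is
proved (the stretched exponential `e^{-C√m}` of Hammersley–Welsh is the state of the art from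
below, exactly as `e^{+C√n}` is from above). [cite: MadrasSlade1993, Theorem 3.2.4 and Corollary 3.1.6] -/
theorem hw_term_lower_bound : ∃ c : ℝ, ∀ M : ℕ, 1 ≤ M →
    criticalFugacity * Real.exp (-(2 * c * Real.sqrt M)) / ((2 * (M : ℝ) + 1) ^ 4 * ((M : ℝ) + 1) ^ 4) ≤
      (Zd.countAt 2 (2 * M + 1) Zd.eDown : ℝ) * criticalFugacity ^ (2 * M + 1) := by
  obtain ⟨c, hc⟩ := Zd.exp_mul_pow_le_bridgeCount (d := 2)
  refine ⟨c, fun M hM => ?_⟩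
  obtain ⟨m, -, hm⟩ := Zd.sq_bridgeCount_le_card_targetWalks hM
  have h1 : (Zd.targetWalks M m).card ≤ Zd.countAt 2 (2 * M + 1) Zd.eDown := by
    rw [← Zd.card_sawFun]
    exact Finset.card_filter_le _ _
  set μ : ℝ := Zd.connectiveConstant 2 with hμdef
  have hμ : 0 < μ := Zd.connectiveConstant_pos 2
  have hxc : criticalFugacity = μ⁻¹ := rfl
  have hb : Real.exp (-(c * Real.sqrt M)) * μ ^ M ≤ Zd.bridgeCount 2 M := hc M
  have hb2 : (Real.exp (-(c * Real.sqrt M)) * μ ^ M) ^ 2 ≤ (Zd.bridgeCount 2 M : ℝ) ^ 2 :=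
    pow_le_pow_left₀ (by positivity) hb 2
  have hP : (Zd.bridgeCount 2 M : ℝ) ^ 2 ≤
      ((2 * (M : ℝ) + 1) ^ 4 * ((M : ℝ) + 1) ^ 4) * Zd.countAt 2 (2 * M + 1) Zd.eDown := by
    have := hm.trans (Nat.mul_le_mul_left _ h1)
    exact_mod_cast this
  have he : Real.exp (-(2 * c * Real.sqrt M)) = Real.exp (-(c * Real.sqrt M)) ^ 2 := by
    rw [← Real.exp_nat_mul]
    congr 1
    push_cast
    ring
  have hμ0 : μ ≠ 0 := hμ.ne'
  have h0 : 0 ≤ criticalFugacity ^ (2 * M + 1) := pow_nonneg criticalFugacity_pos_lt_one'.1.le _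
  rw [div_le_iff₀ (by positivity)]
  calc criticalFugacity * Real.exp (-(2 * c * Real.sqrt M))
      = (Real.exp (-(c * Real.sqrt M)) * μ ^ M) ^ 2 * criticalFugacity ^ (2 * M + 1) := by
        rw [he, hxc, inv_pow]
        field_simp
        ring
    _ ≤ (Zd.bridgeCount 2 M : ℝ) ^ 2 * criticalFugacity ^ (2 * M + 1) :=
        mul_le_mul_of_nonneg_right hb2 h0
    _ ≤ ((2 * (M : ℝ) + 1) ^ 4 * ((M : ℝ) + 1) ^ 4) * Zd.countAt 2 (2 * M + 1) Zd.eDown *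
          criticalFugacity ^ (2 * M + 1) :=
        mul_le_mul_of_nonneg_right hP h0
    _ = (Zd.countAt 2 (2 * M + 1) Zd.eDown : ℝ) * criticalFugacity ^ (2 * M + 1) *
          ((2 * (M : ℝ) + 1) ^ 4 * ((M : ℝ) + 1) ^ 4) := by ring

/-- `(0,-1)` is a neighbour of the origin, so the lower bound concerns a term of the crux's own
series (all four unit vectors give the same series, §10). [folklore] -/
theorem adj_zero_eDown : (zdGraph 2).Adj 0 Zd.eDown := Zd.adj_zero_eDown

/-- **PROVED UPPER BOUND ON THE TERMS**: `c_n(0,e) x_cⁿ ≤ c_n x_cⁿ ≤ e^{κ√n}` for every `e`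
(Hammersley–Welsh, tree `Zd.BDGS2012_HammersleyWelsh_holds`). Useless for the crux (not even
bounded), recorded to frame the window: proved `e^{-2c√n}/poly ≤ t_n ≤ e^{κ√n}`, conjectured
`t_n ≍ n^{-3/2}`, crux ⟺ `Σ t_n < ∞`. [cite: BDGS2012, §1.5.1, eq. (1.25)] -/
theorem hw_term_upper_bound : ∃ κ : ℝ, ∀ (e : Site 2) (n : ℕ),
    (Zd.countAt 2 n e : ℝ) * criticalFugacity ^ n ≤ Real.exp (κ * Real.sqrt n) := by
  obtain ⟨κ, hκ⟩ := Zd.BDGS2012_HammersleyWelsh_holds 2 le_rfl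
  refine ⟨κ, fun e n => ?_⟩
  set μ : ℝ := Zd.connectiveConstant 2 with hμdef
  have hμ : 0 < μ := Zd.connectiveConstant_pos 2
  have hxc : criticalFugacity = μ⁻¹ := rfl
  have h1 : (Zd.countAt 2 n e : ℝ) ≤ Zd.count 2 n := by exact_mod_cast Zd.countAt_le_count n e
  have h2 : (Zd.count 2 n : ℝ) ≤ μ ^ n * Real.exp (κ * Real.sqrt n) := hκ n
  have hx0 : 0 ≤ criticalFugacity ^ n := pow_nonneg criticalFugacity_pos_lt_one'.1.le _
  calc (Zd.countAt 2 n e : ℝ) * criticalFugacity ^ n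
      ≤ (μ ^ n * Real.exp (κ * Real.sqrt n)) * criticalFugacity ^ n :=
        mul_le_mul_of_nonneg_right (h1.trans h2) hx0
    _ = Real.exp (κ * Real.sqrt n) := by
        rw [hxc, inv_pow]
        field_simp

end Summit.CriticalPhenomena.SAWScalingLimit.Theorems.CriticalBubbleBound.Negative
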